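/-
Copyright (c) 2026. All rights reserved.
Released under Apache 2.0 license as described in the file LICENSE.
Authors: HodgeCM publication cell (pub-hodgecm), model-construction sub-cell, discharge seat `mc-discharge-2`.
-/
import Literature.NumberTheory.GelbartRogawski1991.UnitaryDualPairSeesawConjDeepLevelFixed
import Literature.NumberTheory.GelbartRogawski1991.UnitaryDualPairSeesawCMLines
import HarnessLib

/-!
# Deep principal congruence levels of `U(diag dV)(𝔸_{L,f})` fix `Φ_∞ ⊗ 𝟙_{x₀+𝔫𝒪̂}` under the CM line representations
# `cmLineRepRaw_k`, `cmLineRep_k η_k`, `cmLineRepFin_k η_k`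

Topic `NumberTheory/GelbartRogawski1991`; namespace `Literature.NumberTheory.GelbartRogawski1991.UnitaryDualPair`.
KERNEL ONLY (0 definitions, 0 records, 0 named facts): the instantiation of `UnitaryDualPairSeesawConjDeepLevelFixed` §1
(deep levels fix thin-coset test functions under K-1's renormalised small pairs `seesawConjRep₁/₂` of the conjugated `(34)`
torus) at the CM data of `UnitaryDualPairSeesawCMLines`: CM field `L` (`L⁺ = maximalRealSubfield L`, `c = complexConj`),
`V = diag dV` of rank `N`, the hermitian PLANE `W = diag(a₀, a₁) = ⟨a₀⟩ ⊕ ⟨a₁⟩` with `g = 1`, `C = 1`, and the chosen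
compatible splittings `splittingOf hGR, splittingOf hGR₀, splittingOf hGR₁` ([GelbartRogawski1991, Prop. 3.1.1]) — whose
continuity is FREE (`continuous_pairSplitting_splittingOf`).

* **`exists_nat_forall_dvd_finCongruenceLevel_forall_cmLineRepRaw₀_thinCosetTestFunₗ_eq_self`** /
  **`…cmLineRepRaw₁…`**: for every finite family of thin cosets of `(𝔸_{L⁺,f})^{N × 1}` there is `n₀ ≠ 0` such that for
  every non-zero multiple `M` of `n₀`, every `k ∈ K_{U,f}(M𝓞_L) ≤ U(diag dV)(𝔸_{L,f})`, every `a` and every `Φ_∞`: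
  `ω_k″((1,k), 1) (Φ_∞ ⊗ 𝟙_{x₀(a)+𝔫(a)𝒪̂}) = Φ_∞ ⊗ 𝟙_{x₀(a)+𝔫(a)𝒪̂}` (line `0` under the majorant hypotheses `hρ` — in the
  literal shape of `cmThetaKernelDatum` — and `hρ₀, hρ₁` in K-1's `pairSmall` shape; line `1` unconditionally:
  `λ₄(1) = 1`);
* the `η_k`-twisted **`…cmLineRep₀…` / `…cmLineRep₁…`** (one more character `η_k` of `U(diag dV)(𝔸) × U(1)(𝔸)` with
  continuous values, the shape `hηc` of `continuous_cmPairSplittingTwist`; the level is a common multiple of the raw level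
  and of a level killing `k ↦ η_k((1,k), 1)`);
* the `Fin n₁`-currency **`…cmLineRepFin₀…` / `…cmLineRepFin₁…`**:
  `cmLineRepFin_k η_k ((1,k), 1) (φ_∞ ⊗ 𝟙_{x₀+𝔫𝒪̂^{Fin n₁}}) = φ_∞ ⊗ 𝟙_{x₀+𝔫𝒪̂^{Fin n₁}}` for `k` in a deep integer level,
  every member of a finite family of thin cosets of `(𝔸_{L⁺,f})^{n₁}` and every `φ_∞` (transport along `R_{e₁}`,
  `Weil1964.piSBReindex_thinCosetTestFunₗ`).

USE (pub-hodgecm model layer, row `S` (S-restr)/(x-S), E-binder `C`, fields (W-Kf′) `fixN` / (Θ-sat) `sat`): with the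
PKG dictionary `testFun K J Φ x₀ N = thinCosetTestFunₗ (finEmb x₀) (N) Φ` and the period packet's line representation
`((S V c).P k).ω := cmLineRepFin_k η_k` (pulled back along the consumer's frame isomorphisms), the last item is the finite
factor of `ArchKTypeData.fixN`: the finite `K`-type `K₂ := K_{U,f}(M)` fixes every `φ_N(Φ_∞)`.  Nothing here is a claim
of the manuscripts under adjudication: kernel analysis over the tree's constructed objects; the `CompatibleSplitting`
inputs are [GelbartRogawski1991, Prop. 3.1.1] verbatim, the majorant inputs are Weil's [Weil1964, n° 41 Lemme 5 /
Thm 6 (1)].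

References (provenance): S. Gelbart, J. Rogawski, Invent. Math. 105 (1991), §3.1 pp. 454–457, Remark p. 457; A. Weil,
Acta Math. 111 (1964), Chap. III n° 37–41 pp. 187–194; R. Howe, *θ-series and invariant theory* (1979) §3; S. Kudla,
*Seesaw dual reductive pairs* (1984) §1.
-/

set_option autoImplicit false

noncomputable section

open scoped Matrix Kronecker SchwartzMap Classical
open NumberField NumberField.mixedEmbedding IsDedekindDomain
open Literature.RepresentationTheory
open Literature.NumberTheory.Automorphic
open Literature.NumberTheory.Automorphic.UnitaryGroup
open Literature.NumberTheory.Weil1964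

namespace Literature.NumberTheory.GelbartRogawski1991

namespace UnitaryDualPair

section CMLines

variable (L : Type) [Field L] [NumberField L] [IsCMField L] {N n n₁ : ℕ}
  (e : Fin N × Fin 2 ≃ Fin n) (e₁ : Fin N × Fin 1 ≃ Fin n₁)
variable (dV : Fin N → L) (hdV : ∀ i, IsCMField.complexConj L (dV i) = dV i) (hdV0 : ∀ i, dV i ≠ 0)
variable (a : Fin 2 → L) (ha : ∀ i, IsCMField.complexConj L (a i) = a i) (ha0 : ∀ i, a i ≠ 0)
variable (hGR : (cmSplittingDatum L e dV hdV hdV0 a ha ha0).CompatibleSplitting)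
  (hGR₀ : (cmSplittingDatum L e₁ dV hdV hdV0 (lineVec L (a 0)) (fun _ => ha 0) (fun _ => ha0 0)).CompatibleSplitting)
  (hGR₁ : (cmSplittingDatum L e₁ dV hdV hdV0 (lineVec L (a 1)) (fun _ => ha 1) (fun _ => ha0 1)).CompatibleSplitting)
  (η₀ η₁ : CMAdelic L dV × CMAdelicOne L →* ℂˣ)

/-! Weil's majorant hypotheses at the CM data: `hρ` for the big pair `ω_ψ ∘ s_pair` in the literal shape of
`cmThetaKernelDatum` (delivered by `Weil1964.hasThetaMajorants_cmPairSplitting_of_signs_two`), `hρ₀`, `hρ₁` for the two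
line pairs `ω ∘ pairSmall_j (splittingOf hGR_j)` in K-1's `pairSmall` shape. -/
variable
  (hρ : HasThetaMajorants fun (p : CMAdelic L dV × CMAdelic L a)
      (Φ : piSchwartzBruhat (↥(maximalRealSubfield L)) (Fin n)) =>
    adelicMpCont.omega (↥(maximalRealSubfield L)) (Fin n)
      (adelicGram (↥(maximalRealSubfield L)) e (realDiagonal L dV hdV) (realDiagonal L a ha))
      (cmPairSplitting L e dV hdV hdV0 a ha ha0 hGR p) Φ)
  (hρ₀ : HasThetaMajorants fun (p : CMAdelic L dV × CMAdelic L (lineVec L (a 0)))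
      (Φ : piSchwartzBruhat (↥(maximalRealSubfield L)) (Fin N × Fin 1)) =>
    adelicMpCont.omega (↥(maximalRealSubfield L)) (Fin N × Fin 1)
      ((realDiagonal L dV hdV).map (algebraMap (↥(maximalRealSubfield L))
          (AdeleRing (𝓞 ↥(maximalRealSubfield L)) ↥(maximalRealSubfield L))) ⊗ₖ
        (realDiagonal L (lineVec L (a 0)) fun _ => ha 0).map (algebraMap (↥(maximalRealSubfield L))
          (AdeleRing (𝓞 ↥(maximalRealSubfield L)) ↥(maximalRealSubfield L))))
      (pairSmall₁ (↥(maximalRealSubfield L)) L (IsCMField.complexConj L) N 1 e₁ (Matrix.diagonal dV)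
        (Matrix.diagonal (lineVec L (a 0)))
        (splittingOf (↥(maximalRealSubfield L)) L (IsCMField.complexConj L) N 1 e₁ (Matrix.diagonal dV)
          (Matrix.diagonal (lineVec L (a 0))) (complexConj_imagUnit L) (imagUnit_ne_zero L) (imagUnit_mul_self L)
          (realDiagonal_isSymm L dV hdV) (realDiagonal_isSymm L (lineVec L (a 0)) fun _ => ha 0)
          (isUnit_det_realDiagonal L dV hdV hdV0) (isUnit_det_realDiagonal L (lineVec L (a 0)) (fun _ => ha 0) fun _ => ha0 0)
          (realDiagonal_map L dV hdV).symm (realDiagonal_map L (lineVec L (a 0)) fun _ => ha 0).symm hGR₀) p) Φ)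
  (hρ₁ : HasThetaMajorants fun (p : CMAdelic L dV × CMAdelic L (lineVec L (a 1)))
      (Φ : piSchwartzBruhat (↥(maximalRealSubfield L)) (Fin N × Fin 1)) =>
    adelicMpCont.omega (↥(maximalRealSubfield L)) (Fin N × Fin 1)
      ((realDiagonal L dV hdV).map (algebraMap (↥(maximalRealSubfield L))
          (AdeleRing (𝓞 ↥(maximalRealSubfield L)) ↥(maximalRealSubfield L))) ⊗ₖ
        (realDiagonal L (lineVec L (a 1)) fun _ => ha 1).map (algebraMap (↥(maximalRealSubfield L))
          (AdeleRing (𝓞 ↥(maximalRealSubfield L)) ↥(maximalRealSubfield L))))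
      (pairSmall₂ (↥(maximalRealSubfield L)) L (IsCMField.complexConj L) N 1 e₁ (Matrix.diagonal dV)
        (Matrix.diagonal (lineVec L (a 1)))
        (splittingOf (↥(maximalRealSubfield L)) L (IsCMField.complexConj L) N 1 e₁ (Matrix.diagonal dV)
          (Matrix.diagonal (lineVec L (a 1))) (complexConj_imagUnit L) (imagUnit_ne_zero L) (imagUnit_mul_self L)
          (realDiagonal_isSymm L dV hdV) (realDiagonal_isSymm L (lineVec L (a 1)) fun _ => ha 1)
          (isUnit_det_realDiagonal L dV hdV hdV0) (isUnit_det_realDiagonal L (lineVec L (a 1)) (fun _ => ha 1) fun _ => ha0 1)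
          (realDiagonal_map L dV hdV).symm (realDiagonal_map L (lineVec L (a 1)) fun _ => ha 1).symm hGR₁) p) Φ)

include hρ hρ₀ hρ₁ in
/-- **`ω₀″ = cmLineRepRaw₀` fixes `Φ_∞ ⊗ 𝟙_{x₀+𝔫𝒪̂}` on deep levels of `U(diag dV)(𝔸_{L,f})`.** Under Weil's majorants for
the CM pair `(U(diag dV), U(diag a))` and for the two line pairs `(U(diag dV), U(⟨a_k⟩))`, for every finite family of thin
cosets of `(𝔸_{L⁺,f})^{N × 1}` there is `n₀ ≠ 0` such that for every non-zero multiple `M` of `n₀`, every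
`k ∈ K_{U,f}(M𝓞_L) ≤ U(diag dV)(𝔸_{L,f})`, every `a` and every `Φ_∞`:
`ω₀″((1,k), 1) (Φ_∞ ⊗ 𝟙_{x₀(a)+𝔫(a)𝒪̂}) = Φ_∞ ⊗ 𝟙_{x₀(a)+𝔫(a)𝒪̂}` (the chosen compatible splittings are continuous:
`continuous_pairSplitting_splittingOf`). [cite: GelbartRogawski1991, §3.1 p. 454, Remark p. 457; Weil1964, Chap. III n° 41 Thm 6 p. 193] -/
theorem exists_nat_forall_dvd_finCongruenceLevel_forall_cmLineRepRaw₀_thinCosetTestFunₗ_eq_self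
    {A : Type*} [Finite A]
    (x₀ : A → Fin N × Fin 1 → FiniteAdeleRing (𝓞 ↥(maximalRealSubfield L)) ↥(maximalRealSubfield L))
    (𝔫 : A → Ideal (𝓞 ↥(maximalRealSubfield L))) :
    ∃ n₀ : ℕ, n₀ ≠ 0 ∧ ∀ M : ℕ, M ≠ 0 → n₀ ∣ M →
      ∀ k ∈ finCongruenceLevel (↥(maximalRealSubfield L)) L (IsCMField.complexConj L) N (Matrix.diagonal dV)
        (Ideal.span {(M : 𝓞 L)}),
        ∀ a', ∀ Φ : 𝓢((Fin N × Fin 1 → mixedSpace ↥(maximalRealSubfield L)), ℂ),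
          cmLineRepRaw₀ L e e₁ dV hdV hdV0 a ha ha0 hGR hGR₀ hGR₁
              (finAdelicToAdelic (↥(maximalRealSubfield L)) L (IsCMField.complexConj L) N (Matrix.diagonal dV) k, 1)
              (thinCosetTestFunₗ (K := ↥(maximalRealSubfield L)) (ι := Fin N × Fin 1) (x₀ a') (𝔫 a') Φ) =
            thinCosetTestFunₗ (K := ↥(maximalRealSubfield L)) (ι := Fin N × Fin 1) (x₀ a') (𝔫 a') Φ :=
  exists_nat_forall_dvd_finCongruenceLevel_forall_seesawConjRep₁_thinCosetTestFunₗ_eq_self_of_hasThetaMajorants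
    (↥(maximalRealSubfield L)) L (IsCMField.complexConj L) N 1 1 e e₁ e₁ (Matrix.diagonal dV)
    (Matrix.diagonal a) (Matrix.diagonal (lineVec L (a 0))) (Matrix.diagonal (lineVec L (a 1)))
    (complexConj_imagUnit L) (imagUnit_ne_zero L) (imagUnit_mul_self L)
    (realDiagonal_isSymm L dV hdV) (realDiagonal_isSymm L a ha)
    (realDiagonal_isSymm L (lineVec L (a 0)) fun _ => ha 0) (realDiagonal_isSymm L (lineVec L (a 1)) fun _ => ha 1)
    (isUnit_det_realDiagonal L dV hdV hdV0) (isUnit_det_realDiagonal L a ha ha0)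
    (isUnit_det_realDiagonal L (lineVec L (a 0)) (fun _ => ha 0) fun _ => ha0 0)
    (isUnit_det_realDiagonal L (lineVec L (a 1)) (fun _ => ha 1) fun _ => ha0 1)
    ((Matrix.isUnit_iff_isUnit_det _).1
      (isUnit_kronecker_map (↥(maximalRealSubfield L)) N (isUnit_det_realDiagonal L dV hdV hdV0)
        (isUnit_det_realDiagonal L a ha ha0)))
    (realDiagonal_map L dV hdV).symm (realDiagonal_map L a ha).symm
    (realDiagonal_map L (lineVec L (a 0)) fun _ => ha 0).symm (realDiagonal_map L (lineVec L (a 1)) fun _ => ha 1).symm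
    (coe_one_GL_eq_map L (AdeleRing (𝓞 L) L) (Fin (1 + 1))) (adelicIsometry_one_lineVec L a)
    (coe_one_GL_eq_map (↥(maximalRealSubfield L)) (AdeleRing (𝓞 ↥(maximalRealSubfield L)) ↥(maximalRealSubfield L))
      (Fin N × Fin (1 + 1)))
    (gramIntertwiner_one_lineVec L a ha (realDiagonal L dV hdV))
    (splittingOf_isCompatible _ _ _ _ _ _ _ _ _ _ _ _ _ _ _ _ _ hGR)
    (splittingOf_isCompatible _ _ _ _ _ _ _ _ _ _ _ _ _ _ _ _ _ hGR₀)
    (splittingOf_isCompatible _ _ _ _ _ _ _ _ _ _ _ _ _ _ _ _ _ hGR₁) hρ hρ₀ hρ₁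
    (continuous_pairSplitting_splittingOf _ _ _ _ _ _ _ _ _ _ _ _ _ _ _ _ _ hGR₀) x₀ 𝔫

/-- **`ω₁″ = cmLineRepRaw₁` fixes `Φ_∞ ⊗ 𝟙_{x₀+𝔫𝒪̂}` on deep levels of `U(diag dV)(𝔸_{L,f})`** (the `k = 1` line; no
majorant hypothesis: the twist `λ₄(1) = 1` is trivial at `((1,k), 1)`).
[cite: GelbartRogawski1991, §3.1 p. 454, Remark p. 457; Weil1964, Chap. III n° 37–39 pp. 187–190] -/
theorem exists_nat_forall_dvd_finCongruenceLevel_forall_cmLineRepRaw₁_thinCosetTestFunₗ_eq_self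
    {A : Type*} [Finite A]
    (x₀ : A → Fin N × Fin 1 → FiniteAdeleRing (𝓞 ↥(maximalRealSubfield L)) ↥(maximalRealSubfield L))
    (𝔫 : A → Ideal (𝓞 ↥(maximalRealSubfield L))) :
    ∃ n₀ : ℕ, n₀ ≠ 0 ∧ ∀ M : ℕ, M ≠ 0 → n₀ ∣ M →
      ∀ k ∈ finCongruenceLevel (↥(maximalRealSubfield L)) L (IsCMField.complexConj L) N (Matrix.diagonal dV)
        (Ideal.span {(M : 𝓞 L)}),
        ∀ a', ∀ Φ : 𝓢((Fin N × Fin 1 → mixedSpace ↥(maximalRealSubfield L)), ℂ),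
          cmLineRepRaw₁ L e e₁ dV hdV hdV0 a ha ha0 hGR hGR₀ hGR₁
              (finAdelicToAdelic (↥(maximalRealSubfield L)) L (IsCMField.complexConj L) N (Matrix.diagonal dV) k, 1)
              (thinCosetTestFunₗ (K := ↥(maximalRealSubfield L)) (ι := Fin N × Fin 1) (x₀ a') (𝔫 a') Φ) =
            thinCosetTestFunₗ (K := ↥(maximalRealSubfield L)) (ι := Fin N × Fin 1) (x₀ a') (𝔫 a') Φ :=
  exists_nat_forall_dvd_finCongruenceLevel_forall_seesawConjRep₂_thinCosetTestFunₗ_eq_self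
    (↥(maximalRealSubfield L)) L (IsCMField.complexConj L) N 1 1 e e₁ e₁ (Matrix.diagonal dV)
    (Matrix.diagonal a) (Matrix.diagonal (lineVec L (a 0))) (Matrix.diagonal (lineVec L (a 1)))
    (complexConj_imagUnit L) (imagUnit_ne_zero L) (imagUnit_mul_self L)
    (realDiagonal_isSymm L dV hdV) (realDiagonal_isSymm L a ha)
    (realDiagonal_isSymm L (lineVec L (a 0)) fun _ => ha 0) (realDiagonal_isSymm L (lineVec L (a 1)) fun _ => ha 1)
    (isUnit_det_realDiagonal L dV hdV hdV0) (isUnit_det_realDiagonal L a ha ha0)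
    (isUnit_det_realDiagonal L (lineVec L (a 0)) (fun _ => ha 0) fun _ => ha0 0)
    (isUnit_det_realDiagonal L (lineVec L (a 1)) (fun _ => ha 1) fun _ => ha0 1)
    ((Matrix.isUnit_iff_isUnit_det _).1
      (isUnit_kronecker_map (↥(maximalRealSubfield L)) N (isUnit_det_realDiagonal L dV hdV hdV0)
        (isUnit_det_realDiagonal L a ha ha0)))
    (realDiagonal_map L dV hdV).symm (realDiagonal_map L a ha).symm
    (realDiagonal_map L (lineVec L (a 0)) fun _ => ha 0).symm (realDiagonal_map L (lineVec L (a 1)) fun _ => ha 1).symm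
    (coe_one_GL_eq_map L (AdeleRing (𝓞 L) L) (Fin (1 + 1))) (adelicIsometry_one_lineVec L a)
    (coe_one_GL_eq_map (↥(maximalRealSubfield L)) (AdeleRing (𝓞 ↥(maximalRealSubfield L)) ↥(maximalRealSubfield L))
      (Fin N × Fin (1 + 1)))
    (gramIntertwiner_one_lineVec L a ha (realDiagonal L dV hdV))
    (splittingOf_isCompatible _ _ _ _ _ _ _ _ _ _ _ _ _ _ _ _ _ hGR)
    (splittingOf_isCompatible _ _ _ _ _ _ _ _ _ _ _ _ _ _ _ _ _ hGR₀)
    (splittingOf_isCompatible _ _ _ _ _ _ _ _ _ _ _ _ _ _ _ _ _ hGR₁)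
    (continuous_pairSplitting_splittingOf _ _ _ _ _ _ _ _ _ _ _ _ _ _ _ _ _ hGR₁) x₀ 𝔫

include hρ hρ₀ hρ₁ in
/-- **`cmLineRep₀ η₀ = η₀ • ω₀″` fixes `Φ_∞ ⊗ 𝟙_{x₀+𝔫𝒪̂}` on deep levels**, for a twisting character `η₀` of
`U(diag dV)(𝔸) × U(1)(𝔸)` with continuous values: the level is a common multiple of the level of `ω₀″` and of a level
killing `k ↦ η₀((1,k), 1)` (`UnitaryGroup.exists_nat_forall_dvd_finCongruenceLevel_le_ker`).
[cite: GelbartRogawski1991, §3.1 p. 454, Remark p. 457 L4–13; Weil1964, Chap. III n° 41 Thm 6 p. 193] -/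
theorem exists_nat_forall_dvd_finCongruenceLevel_forall_cmLineRep₀_thinCosetTestFunₗ_eq_self
    (hη₀ : Continuous fun p : CMAdelic L dV × CMAdelicOne L => ((η₀ p : ℂˣ) : ℂ))
    {A : Type*} [Finite A]
    (x₀ : A → Fin N × Fin 1 → FiniteAdeleRing (𝓞 ↥(maximalRealSubfield L)) ↥(maximalRealSubfield L))
    (𝔫 : A → Ideal (𝓞 ↥(maximalRealSubfield L))) :
    ∃ n₀ : ℕ, n₀ ≠ 0 ∧ ∀ M : ℕ, M ≠ 0 → n₀ ∣ M →
      ∀ k ∈ finCongruenceLevel (↥(maximalRealSubfield L)) L (IsCMField.complexConj L) N (Matrix.diagonal dV)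
        (Ideal.span {(M : 𝓞 L)}),
        ∀ a', ∀ Φ : 𝓢((Fin N × Fin 1 → mixedSpace ↥(maximalRealSubfield L)), ℂ),
          cmLineRep₀ L e e₁ dV hdV hdV0 a ha ha0 hGR hGR₀ hGR₁ η₀
              (finAdelicToAdelic (↥(maximalRealSubfield L)) L (IsCMField.complexConj L) N (Matrix.diagonal dV) k, 1)
              (thinCosetTestFunₗ (K := ↥(maximalRealSubfield L)) (ι := Fin N × Fin 1) (x₀ a') (𝔫 a') Φ) =
            thinCosetTestFunₗ (K := ↥(maximalRealSubfield L)) (ι := Fin N × Fin 1) (x₀ a') (𝔫 a') Φ := by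
  have hex₁ := exists_nat_forall_dvd_finCongruenceLevel_forall_cmLineRepRaw₀_thinCosetTestFunₗ_eq_self L e e₁ dV hdV
    hdV0 a ha ha0 hGR hGR₀ hGR₁ hρ hρ₀ hρ₁ x₀ 𝔫
  obtain ⟨n₁, hn₁, hfix⟩ := hex₁
  -- the twisting character read on `U(diag dV)(𝔸_{L,f})` along `k ↦ ((1,k), 1)`
  let χ : finAdelic (↥(maximalRealSubfield L)) L (IsCMField.complexConj L) N (Matrix.diagonal dV) →* ℂˣ :=
    η₀.comp ((MonoidHom.inl _ _).comp
      (finAdelicToAdelic (↥(maximalRealSubfield L)) L (IsCMField.complexConj L) N (Matrix.diagonal dV)))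
  have hχval : Continuous fun k => ((χ k : ℂˣ) : ℂ) :=
    hη₀.comp ((continuous_finAdelicToAdelic _ L _ N _).prodMk continuous_const)
  have hχ : ContinuousAt χ 1 := (χ.continuous_of_continuous_units_val hχval).continuousAt
  have hex₂ := UnitaryGroup.exists_nat_forall_dvd_finCongruenceLevel_le_ker χ hχ
  obtain ⟨n₂, hn₂, hker⟩ := hex₂
  refine ⟨n₁ * n₂, mul_ne_zero hn₁ hn₂, fun M hM hdvd k hk a' Φ => ?_⟩
  have hη1 : η₀ (finAdelicToAdelic (↥(maximalRealSubfield L)) L (IsCMField.complexConj L) N (Matrix.diagonal dV) k, 1) =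
      1 :=
    hker M hM (dvd_of_mul_left_dvd hdvd) k hk
  rw [cmLineRep₀_apply, map_one, hfix M hM (dvd_of_mul_right_dvd hdvd) k hk a' Φ, hη1, Units.val_one, one_smul]

/-- **`cmLineRep₁ η₁ = η₁ • ω₁″` fixes `Φ_∞ ⊗ 𝟙_{x₀+𝔫𝒪̂}` on deep levels** (twisting character `η₁` with continuous values;
no majorant hypothesis). [cite: GelbartRogawski1991, §3.1 p. 454, Remark p. 457 L4–13; Weil1964, Chap. III n° 37–39 pp. 187–190] -/
theorem exists_nat_forall_dvd_finCongruenceLevel_forall_cmLineRep₁_thinCosetTestFunₗ_eq_self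
    (hη₁ : Continuous fun p : CMAdelic L dV × CMAdelicOne L => ((η₁ p : ℂˣ) : ℂ))
    {A : Type*} [Finite A]
    (x₀ : A → Fin N × Fin 1 → FiniteAdeleRing (𝓞 ↥(maximalRealSubfield L)) ↥(maximalRealSubfield L))
    (𝔫 : A → Ideal (𝓞 ↥(maximalRealSubfield L))) :
    ∃ n₀ : ℕ, n₀ ≠ 0 ∧ ∀ M : ℕ, M ≠ 0 → n₀ ∣ M →
      ∀ k ∈ finCongruenceLevel (↥(maximalRealSubfield L)) L (IsCMField.complexConj L) N (Matrix.diagonal dV)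
        (Ideal.span {(M : 𝓞 L)}),
        ∀ a', ∀ Φ : 𝓢((Fin N × Fin 1 → mixedSpace ↥(maximalRealSubfield L)), ℂ),
          cmLineRep₁ L e e₁ dV hdV hdV0 a ha ha0 hGR hGR₀ hGR₁ η₁
              (finAdelicToAdelic (↥(maximalRealSubfield L)) L (IsCMField.complexConj L) N (Matrix.diagonal dV) k, 1)
              (thinCosetTestFunₗ (K := ↥(maximalRealSubfield L)) (ι := Fin N × Fin 1) (x₀ a') (𝔫 a') Φ) =
            thinCosetTestFunₗ (K := ↥(maximalRealSubfield L)) (ι := Fin N × Fin 1) (x₀ a') (𝔫 a') Φ := by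
  have hex₁ := exists_nat_forall_dvd_finCongruenceLevel_forall_cmLineRepRaw₁_thinCosetTestFunₗ_eq_self L e e₁ dV hdV
    hdV0 a ha ha0 hGR hGR₀ hGR₁ x₀ 𝔫
  obtain ⟨n₁, hn₁, hfix⟩ := hex₁
  let χ : finAdelic (↥(maximalRealSubfield L)) L (IsCMField.complexConj L) N (Matrix.diagonal dV) →* ℂˣ :=
    η₁.comp ((MonoidHom.inl _ _).comp
      (finAdelicToAdelic (↥(maximalRealSubfield L)) L (IsCMField.complexConj L) N (Matrix.diagonal dV)))
  have hχval : Continuous fun k => ((χ k : ℂˣ) : ℂ) :=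
    hη₁.comp ((continuous_finAdelicToAdelic _ L _ N _).prodMk continuous_const)
  have hχ : ContinuousAt χ 1 := (χ.continuous_of_continuous_units_val hχval).continuousAt
  have hex₂ := UnitaryGroup.exists_nat_forall_dvd_finCongruenceLevel_le_ker χ hχ
  obtain ⟨n₂, hn₂, hker⟩ := hex₂
  refine ⟨n₁ * n₂, mul_ne_zero hn₁ hn₂, fun M hM hdvd k hk a' Φ => ?_⟩
  have hη1 : η₁ (finAdelicToAdelic (↥(maximalRealSubfield L)) L (IsCMField.complexConj L) N (Matrix.diagonal dV) k, 1) =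
      1 :=
    hker M hM (dvd_of_mul_left_dvd hdvd) k hk
  rw [cmLineRep₁_apply, map_one, hfix M hM (dvd_of_mul_right_dvd hdvd) k hk a' Φ, hη1, Units.val_one, one_smul]

include hρ hρ₀ hρ₁ in
/-- **`Fin n₁` currency: `cmLineRepFin₀ η₀ ((1,k), 1) (φ_∞ ⊗ 𝟙_{x₀+𝔫𝒪̂^{Fin n₁}}) = φ_∞ ⊗ 𝟙_{x₀+𝔫𝒪̂^{Fin n₁}}`** for `k` in
a deep integer level of `U(diag dV)(𝔸_{L,f})`, every member of a finite family of thin cosets of `(𝔸_{L⁺,f})^{n₁}` and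
every `φ_∞` (transport of the `Fin N × Fin 1` statement along `R_{e₁}`, `piSBReindex_thinCosetTestFunₗ`) — the finite
factor of the Hodge-CM `ArchKTypeData.fixN` for the first line.
[cite: GelbartRogawski1991, §3.1 p. 454, Remark p. 457 L4–13; Weil1964, Chap. III n° 41 Thm 6 p. 193] -/
theorem exists_nat_forall_dvd_finCongruenceLevel_forall_cmLineRepFin₀_thinCosetTestFunₗ_eq_self
    (hη₀ : Continuous fun p : CMAdelic L dV × CMAdelicOne L => ((η₀ p : ℂˣ) : ℂ))
    {A : Type*} [Finite A]
    (x₀ : A → Fin n₁ → FiniteAdeleRing (𝓞 ↥(maximalRealSubfield L)) ↥(maximalRealSubfield L))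
    (𝔫 : A → Ideal (𝓞 ↥(maximalRealSubfield L))) :
    ∃ n₀ : ℕ, n₀ ≠ 0 ∧ ∀ M : ℕ, M ≠ 0 → n₀ ∣ M →
      ∀ k ∈ finCongruenceLevel (↥(maximalRealSubfield L)) L (IsCMField.complexConj L) N (Matrix.diagonal dV)
        (Ideal.span {(M : 𝓞 L)}),
        ∀ a', ∀ φ : 𝓢((Fin n₁ → mixedSpace ↥(maximalRealSubfield L)), ℂ),
          cmLineRepFin₀ L e e₁ dV hdV hdV0 a ha ha0 hGR hGR₀ hGR₁ η₀
              (finAdelicToAdelic (↥(maximalRealSubfield L)) L (IsCMField.complexConj L) N (Matrix.diagonal dV) k, 1)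
              (thinCosetTestFunₗ (K := ↥(maximalRealSubfield L)) (ι := Fin n₁) (x₀ a') (𝔫 a') φ) =
            thinCosetTestFunₗ (K := ↥(maximalRealSubfield L)) (ι := Fin n₁) (x₀ a') (𝔫 a') φ := by
  have hex := exists_nat_forall_dvd_finCongruenceLevel_forall_cmLineRep₀_thinCosetTestFunₗ_eq_self L e e₁ dV hdV hdV0
    a ha ha0 hGR hGR₀ hGR₁ η₀ hρ hρ₀ hρ₁ hη₀ (fun a' => x₀ a' ∘ e₁) 𝔫
  obtain ⟨n₀, hn₀, hfix⟩ := hex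
  refine ⟨n₀, hn₀, fun M hM hdvd k hk a' φ => ?_⟩
  have hψ : (piSBReindex (↥(maximalRealSubfield L)) e₁).symm
        (thinCosetTestFunₗ (K := ↥(maximalRealSubfield L)) (ι := Fin n₁) (x₀ a') (𝔫 a') φ) =
      thinCosetTestFunₗ (K := ↥(maximalRealSubfield L)) (ι := Fin N × Fin 1) (x₀ a' ∘ e₁) (𝔫 a')
        (schwartzReindexCLM (↥(maximalRealSubfield L)) e₁.symm φ) := by
    rw [piSBReindex_symm, piSBReindex_thinCosetTestFunₗ, Equiv.symm_symm]
  rw [cmLineRepFin₀_apply, map_one, hψ, hfix M hM hdvd k hk a', ← hψ, LinearEquiv.apply_symm_apply]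

/-- **`Fin n₁` currency, second line: `cmLineRepFin₁ η₁ ((1,k), 1) (φ_∞ ⊗ 𝟙_{x₀+𝔫𝒪̂^{Fin n₁}}) = φ_∞ ⊗ 𝟙_{x₀+𝔫𝒪̂^{Fin n₁}}`**
on deep levels (no majorant hypothesis). [cite: GelbartRogawski1991, §3.1 p. 454, Remark p. 457 L4–13; Weil1964, Chap. III n° 37–39 pp. 187–190] -/
theorem exists_nat_forall_dvd_finCongruenceLevel_forall_cmLineRepFin₁_thinCosetTestFunₗ_eq_self
    (hη₁ : Continuous fun p : CMAdelic L dV × CMAdelicOne L => ((η₁ p : ℂˣ) : ℂ))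
    {A : Type*} [Finite A]
    (x₀ : A → Fin n₁ → FiniteAdeleRing (𝓞 ↥(maximalRealSubfield L)) ↥(maximalRealSubfield L))
    (𝔫 : A → Ideal (𝓞 ↥(maximalRealSubfield L))) :
    ∃ n₀ : ℕ, n₀ ≠ 0 ∧ ∀ M : ℕ, M ≠ 0 → n₀ ∣ M →
      ∀ k ∈ finCongruenceLevel (↥(maximalRealSubfield L)) L (IsCMField.complexConj L) N (Matrix.diagonal dV)
        (Ideal.span {(M : 𝓞 L)}),
        ∀ a', ∀ φ : 𝓢((Fin n₁ → mixedSpace ↥(maximalRealSubfield L)), ℂ),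
          cmLineRepFin₁ L e e₁ dV hdV hdV0 a ha ha0 hGR hGR₀ hGR₁ η₁
              (finAdelicToAdelic (↥(maximalRealSubfield L)) L (IsCMField.complexConj L) N (Matrix.diagonal dV) k, 1)
              (thinCosetTestFunₗ (K := ↥(maximalRealSubfield L)) (ι := Fin n₁) (x₀ a') (𝔫 a') φ) =
            thinCosetTestFunₗ (K := ↥(maximalRealSubfield L)) (ι := Fin n₁) (x₀ a') (𝔫 a') φ := by
  have hex := exists_nat_forall_dvd_finCongruenceLevel_forall_cmLineRep₁_thinCosetTestFunₗ_eq_self L e e₁ dV hdV hdV0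
    a ha ha0 hGR hGR₀ hGR₁ η₁ hη₁ (fun a' => x₀ a' ∘ e₁) 𝔫
  obtain ⟨n₀, hn₀, hfix⟩ := hex
  refine ⟨n₀, hn₀, fun M hM hdvd k hk a' φ => ?_⟩
  have hψ : (piSBReindex (↥(maximalRealSubfield L)) e₁).symm
        (thinCosetTestFunₗ (K := ↥(maximalRealSubfield L)) (ι := Fin n₁) (x₀ a') (𝔫 a') φ) =
      thinCosetTestFunₗ (K := ↥(maximalRealSubfield L)) (ι := Fin N × Fin 1) (x₀ a' ∘ e₁) (𝔫 a')
        (schwartzReindexCLM (↥(maximalRealSubfield L)) e₁.symm φ) := by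
    rw [piSBReindex_symm, piSBReindex_thinCosetTestFunₗ, Equiv.symm_symm]
  rw [cmLineRepFin₁_apply, map_one, hψ, hfix M hM hdvd k hk a', ← hψ, LinearEquiv.apply_symm_apply]

end CMLines

end UnitaryDualPair

end Literature.NumberTheory.GelbartRogawski1991

end

/-! ### Build-lane note (ops-buildfix G11b-3 recipe v2, LEDGER B13-1/B14-5/B14-7, 2026-08-22)
`lean -o` (the hub build lane, never `lean`/the gate check) runs Lean 4.32's library-suggestion indexers
(`Lean.LibrarySuggestions.SymbolFrequency` / `SineQuaNon`, from their `exportEntriesFn`) over the statement of every local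
theorem constant that is not a denied premise; on this family's statements (very large dependent binder telescopes) that fold
runs for tens of minutes (incident G11b-3, run/shared/lean/ops/buildfix/G11b-3-DOSSIER.md). `isDeniedPremise` skips
`[implicit_reducible]` constants before any fold, and the status is inert on theorems (Meta never unfolds `thmInfo`).
v2 form: ONE file-final, top-level `local` attribute — it goes through the synchronous scoped reducibility extension that
`getReducibilityStatusCore` reads first, so it needs no `set_option Elab.async false` (parallel elaboration stays on), also
reaches auto-realized `*.congr_simp` / structure-projection theorem constants, is never popped before export, and is not
exported. No statement or proof is changed. -/
set_option allowUnsafeReducibility true in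
attribute [local implicit_reducible]
  Literature.NumberTheory.GelbartRogawski1991.UnitaryDualPair.exists_nat_forall_dvd_finCongruenceLevel_forall_cmLineRepRaw₀_thinCosetTestFunₗ_eq_self
  Literature.NumberTheory.GelbartRogawski1991.UnitaryDualPair.exists_nat_forall_dvd_finCongruenceLevel_forall_cmLineRepRaw₁_thinCosetTestFunₗ_eq_self
  Literature.NumberTheory.GelbartRogawski1991.UnitaryDualPair.exists_nat_forall_dvd_finCongruenceLevel_forall_cmLineRep₀_thinCosetTestFunₗ_eq_self
  Literature.NumberTheory.GelbartRogawski1991.UnitaryDualPair.exists_nat_forall_dvd_finCongruenceLevel_forall_cmLineRep₁_thinCosetTestFunₗ_eq_self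
  Literature.NumberTheory.GelbartRogawski1991.UnitaryDualPair.exists_nat_forall_dvd_finCongruenceLevel_forall_cmLineRepFin₀_thinCosetTestFunₗ_eq_self
  Literature.NumberTheory.GelbartRogawski1991.UnitaryDualPair.exists_nat_forall_dvd_finCongruenceLevel_forall_cmLineRepFin₁_thinCosetTestFunₗ_eq_self
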